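import Literature.Analysis.Complex.LaguerrePolya
import HarnessLib

/-!
# The two-point vertical certificate for a non-real zero, Hadamard-free

Trunk T-ANALYSIS support (`Literature/Analysis/Complex`), a corollary file of `LaguerrePolya.lean`.

Let `f` be a *real entire function of order `< 2` with only real zeros* (`f` entire,
`‖f(z)‖ ≤ C e^{‖z‖^ρ}` for some `0 ≤ ρ < 2`, `f(ℝ) ⊆ ℝ`, `f(z) = 0 ⇒ z ∈ ℝ`), i.e. a function of the
Laguerre–Pólya class presented without its Hadamard product. `LaguerrePolya.lean` proves that
`y ↦ |f(x + iy)|²` is non-decreasing on `[0, ∞)` (`monotoneOn_norm_sq_vertical`). Here we record the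
consequence that turns the *absence* of non-real zeros into a checkable inequality between two
values of `f`, in the form used by certified numerics (route `RiemannHypothesis/UniversalFactor`,
items LehmerPointNoGo / MediumKernelNoGo):

* `Literature.Analysis.Complex.norm_vertical_le` — `‖f(x + iy₁)‖ ≤ ‖f(x + iy₂)‖` for `0 ≤ y₁ ≤ y₂`;
* `Literature.Analysis.Complex.exists_zero_im_ne_zero_of_norm_vertical_lt` (and the case `y₁ = 0`,
  `exists_zero_im_ne_zero_of_norm_vertical_lt_norm_ofReal`) — **two-point certificate**: a strict DROP
  `‖f(x + iy₂)‖ < ‖f(x + iy₁)‖` along a vertical ray leaving the real axis produces a non-real zero.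

(The one-point form — Laguerre's inequality `f f'' ≤ f'²` — is
`Summit.RiemannHypothesis.RiemannHypothesis.Theorems.UniversalFactor.laguerre_inequality`.)

## References

* G. Pólya, J. Schur, *Über zwei Arten von Faktorenfolgen…*, J. reine angew. Math. 144 (1914);
  B. Ja. Levin, *Distribution of zeros of entire functions*, AMS 1964, Ch. VIII (the modulus of a
  Laguerre–Pólya function increases along vertical rays).
* N. G. de Bruijn, *The roots of trigonometric integrals*, Duke Math. J. 17 (1950), §2.
-/

noncomputable section

open Complex Set

namespace Literature.Analysis.Complex

variable {f : ℂ → ℂ}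

/-- For `f` real entire of order `< 2` with only real zeros and `0 ≤ y₁ ≤ y₂`:
`‖f(x + iy₁)‖ ≤ ‖f(x + iy₂)‖` (`monotoneOn_norm_sq_vertical`, square roots taken). [folklore] -/
theorem norm_vertical_le (hf : Differentiable ℂ f) {ρ C : ℝ} (hρ0 : 0 ≤ ρ) (hρ : ρ < 2)
    (hgr : ∀ z, ‖f z‖ ≤ C * Real.exp (‖z‖ ^ ρ)) (hreal : ∀ x : ℝ, (f x).im = 0)
    (hzero : ∀ z, f z = 0 → z.im = 0) (x : ℝ) {y₁ y₂ : ℝ} (hy₁ : 0 ≤ y₁) (h12 : y₁ ≤ y₂) :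
    ‖f (x + I * y₁)‖ ≤ ‖f (x + I * y₂)‖ := by
  have hmono := monotoneOn_norm_sq_vertical hf hρ0 hρ hgr hreal hzero x
  have hsq : ‖f (x + I * y₁)‖ ^ 2 ≤ ‖f (x + I * y₂)‖ ^ 2 :=
    hmono (mem_Ici.2 hy₁) (mem_Ici.2 (hy₁.trans h12)) h12
  exact (pow_le_pow_iff_left₀ (norm_nonneg _) (norm_nonneg _) two_ne_zero).1 hsq

/-- In particular `‖f(x)‖ ≤ ‖f(x + iy)‖` for every real `x` and `y ≥ 0`. [folklore] -/
theorem norm_ofReal_le_norm_vertical (hf : Differentiable ℂ f) {ρ C : ℝ} (hρ0 : 0 ≤ ρ)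
    (hρ : ρ < 2) (hgr : ∀ z, ‖f z‖ ≤ C * Real.exp (‖z‖ ^ ρ)) (hreal : ∀ x : ℝ, (f x).im = 0)
    (hzero : ∀ z, f z = 0 → z.im = 0) (x : ℝ) {y : ℝ} (hy : 0 ≤ y) :
    ‖f x‖ ≤ ‖f (x + I * y)‖ := by
  have h := norm_vertical_le hf hρ0 hρ hgr hreal hzero x le_rfl hy
  simpa using h

/-- **Two-point certificate.** If `f` is real entire of order `< 2` and `‖f(x + iy₂)‖ < ‖f(x + iy₁)‖`
for some real `x` and `0 ≤ y₁ ≤ y₂` (the modulus DROPS along a vertical ray leaving the real axis),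
then `f` has a non-real zero. [folklore] -/
theorem exists_zero_im_ne_zero_of_norm_vertical_lt (hf : Differentiable ℂ f) {ρ C : ℝ}
    (hρ0 : 0 ≤ ρ) (hρ : ρ < 2) (hgr : ∀ z, ‖f z‖ ≤ C * Real.exp (‖z‖ ^ ρ))
    (hreal : ∀ x : ℝ, (f x).im = 0) {x y₁ y₂ : ℝ} (hy₁ : 0 ≤ y₁) (h12 : y₁ ≤ y₂)
    (hlt : ‖f (x + I * y₂)‖ < ‖f (x + I * y₁)‖) : ∃ z, f z = 0 ∧ z.im ≠ 0 := by
  by_contra h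
  push Not at h
  exact absurd (norm_vertical_le hf hρ0 hρ hgr hreal h x hy₁ h12) (not_le.2 hlt)

/-- The special case `y₁ = 0`: `‖f(x + iy)‖ < ‖f(x)‖` for some real `x` and `y ≥ 0` forces a
non-real zero. [folklore] -/
theorem exists_zero_im_ne_zero_of_norm_vertical_lt_norm_ofReal (hf : Differentiable ℂ f) {ρ C : ℝ}
    (hρ0 : 0 ≤ ρ) (hρ : ρ < 2) (hgr : ∀ z, ‖f z‖ ≤ C * Real.exp (‖z‖ ^ ρ))
    (hreal : ∀ x : ℝ, (f x).im = 0) {x y : ℝ} (hy : 0 ≤ y)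
    (hlt : ‖f (x + I * y)‖ < ‖f x‖) : ∃ z, f z = 0 ∧ z.im ≠ 0 := by
  refine exists_zero_im_ne_zero_of_norm_vertical_lt (x := x) hf hρ0 hρ hgr hreal le_rfl hy ?_
  simpa using hlt

end Literature.Analysis.Complex
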